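import Mathlib
import Summits.ValiantsHypothesis.ValiantsHypothesis.Theses.RefutationDegree

/-!
# Sketch — crux `RefutationDegree.RefutationBarrier` (stmt-ValiantsHypothesis-5642), ideator 1, round 1

Idea `arc-contact-exponent`: the Hermitian-SOS / Nullstellensatz refutation degree D(n,m) of
Rep(n,m) is sandwiched, up to the polynomial factor (n²+1)m³, by the ARC-CONTACT EXPONENT
κ(n,m) (a Łojasiewicz exponent at infinity of A ↦ det A(x) − per_n(x) on size-m affine pencils):

  m + κ(n,m) ≤ D_SOS(n,m) ≤ D_NS(n,m) ≤ (n²+1)·m³·(1+κ(n,m)) + m .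

Lower bound: evaluate a refutation at the conjugate points of an approximating arc (squares ≥ 0,
ideal part → 0).  Upper bound: non-border ⇒ growth inequality ⇒ λ := coeff_id integral over the
cone ideal 𝔞 = (F_μ − c_μ λ) ⇒ Briançon–Skoda λ^M ∈ 𝔞 (M = (n²+1)m²) ⇒ dehomogenise.
Padding A ↦ A ⊕ [1] makes D(n,·) monotone, so the crux is its instance m = ⌊n²/2⌋+1, and
RefutationBarrier ⟹ per_n lies in the affine determinantal border of size ⌊n²/2⌋+1 for all
large n (LMR13's border bound would be sharp).  Route-level corollaries, also composed below:
(C4) eventual non-border at ⌊n²/2⌋+1 ⟹ `BeyondHessianNs` (c = 9); (C5) affine border dc of per_n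
not quasi-polynomially bounded ⟹ the route's target `CertWindowQP` (c' = 5).  All statements
elaborate; proofs are not claimed here (ideation stage) except arithmetic and compositions; the
five `sorry`s are exactly the stubs T0 (padding), T1 (arcs kill SOS), T2 (Briançon–Skoda
dichotomy), NsToSos, and the degree-0 refutation below the degree of the permanent.
-/

open scoped BigOperators
open Filter Topology

namespace Summit.ValiantsHypothesis.ValiantsHypothesis.Cruxes.RefutationBarrier.ArcContact

open Summit.ValiantsHypothesis.ValiantsHypothesis.Theses.RefutationDegree
open Literature.Computability.AlgebraicComplexity

/-- unknowns of Rep(n,m): entries of `A₀` (tag `none`) and of `A_e` (tag `some e`). -/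
abbrev U (n m : ℕ) := Option (Fin n × Fin n) × (Fin m × Fin m)

/-- The defect `det(A₀ + Σ_e x_e A_e) − per_n(x)`: a polynomial in `x` whose coefficients are
polynomials (the equations `eqn_μ`) in the unknowns. Literally the `P` of the route file. -/
noncomputable def defect (n m : ℕ) : MvPolynomial (Fin n × Fin n) (MvPolynomial (U n m) ℂ) :=
  (Matrix.of fun i j : Fin m => MvPolynomial.C (MvPolynomial.X (none, (i, j))) + ∑ e : Fin n × Fin n, MvPolynomial.X e * MvPolynomial.C (MvPolynomial.X (some e, (i, j))) : Matrix (Fin m) (Fin m) (MvPolynomial (Fin n × Fin n) (MvPolynomial (U n m) ℂ))).det - MvPolynomial.map MvPolynomial.C (perPoly (Fin n) ℂ)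

/-- Nullstellensatz refutation of Rep(n,m) with all products of degree ≤ D (shape of the route's
`BeyondHessianNs` / `MrCalibration`, general m and D). -/
def HasNsRef (n m D : ℕ) : Prop :=
  (let P : MvPolynomial (Fin n × Fin n) (MvPolynomial (Option (Fin n × Fin n) × (Fin m × Fin m)) ℂ) := (Matrix.of fun i j : Fin m => MvPolynomial.C (MvPolynomial.X (none, (i, j))) + ∑ e : Fin n × Fin n, MvPolynomial.X e * MvPolynomial.C (MvPolynomial.X (some e, (i, j))) : Matrix (Fin m) (Fin m) (MvPolynomial (Fin n × Fin n) (MvPolynomial (Option (Fin n × Fin n) × (Fin m × Fin m)) ℂ))).det - MvPolynomial.map MvPolynomial.C (Literature.Computability.AlgebraicComplexity.perPoly (Fin n) ℂ); ∃ h : ((Fin n × Fin n) →₀ ℕ) → MvPolynomial (Option (Fin n × Fin n) × (Fin m × Fin m)) ℂ, (∀ μ, (h μ * P.coeff μ).totalDegree ≤ D) ∧ ∑ μ ∈ P.support, h μ * P.coeff μ = 1)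

/-- Hermitian-SOS refutation of Rep(n,m) with all products of degree ≤ D — LITERALLY the negated
matrix of the route's `RefutationBarrier` with `n ^ c` replaced by `D`. -/
def HasSosRef (n m D : ℕ) : Prop :=
  (let P : MvPolynomial (Fin n × Fin n) (MvPolynomial (Option (Fin n × Fin n) × (Fin m × Fin m)) ℂ) := (Matrix.of fun i j : Fin m => MvPolynomial.C (MvPolynomial.X (none, (i, j))) + ∑ e : Fin n × Fin n, MvPolynomial.X e * MvPolynomial.C (MvPolynomial.X (some e, (i, j))) : Matrix (Fin m) (Fin m) (MvPolynomial (Fin n × Fin n) (MvPolynomial (Option (Fin n × Fin n) × (Fin m × Fin m)) ℂ))).det - MvPolynomial.map MvPolynomial.C (Literature.Computability.AlgebraicComplexity.perPoly (Fin n) ℂ); let eqn : ((Fin n × Fin n) →₀ ℕ) → MvPolynomial ((Option (Fin n × Fin n) × (Fin m × Fin m)) ⊕ (Option (Fin n × Fin n) × (Fin m × Fin m))) ℂ := fun μ => MvPolynomial.rename Sum.inl (P.coeff μ); let cj : MvPolynomial ((Option (Fin n × Fin n) × (Fin m × Fin m)) ⊕ (Option (Fin n × Fin n) × (Fin m ×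 Fin m))) ℂ → MvPolynomial ((Option (Fin n × Fin n) × (Fin m × Fin m)) ⊕ (Option (Fin n × Fin n) × (Fin m × Fin m))) ℂ := fun p => MvPolynomial.rename Sum.swap (MvPolynomial.map (starRingEnd ℂ) p); ∃ (k : ℕ) (q : Fin k → MvPolynomial ((Option (Fin n × Fin n) × (Fin m × Fin m)) ⊕ (Option (Fin n × Fin n) × (Fin m × Fin m))) ℂ) (h : ((Fin n × Fin n) →₀ ℕ) → MvPolynomial ((Option (Fin n × Fin n) × (Fin m × Fin m)) ⊕ (Option (Fin n × Fin n) × (Fin m × Fin m))) ℂ), (∀ i, (q i * cj (q i)).totalDegree ≤ D) ∧ (∀ μ, (h μ * eqn μ).totalDegree ≤ D) ∧ ∑ i, q i * cj (q i) + ∑ μ ∈ P.support, (h μ * eqn μ + cj (h μ * eqn μ)) + 1 = 0)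

/-- The crux is the statement that `HasSosRef n m (n^c)` fails past the Hessian bound. -/
theorem refutationBarrier_iff :
    RefutationBarrier ↔ ∀ c : ℕ, ∃ n₀ : ℕ, ∀ n ≥ n₀, ∀ m : ℕ, n ^ 2 / 2 + 1 ≤ m → ¬ HasSosRef n m (n ^ c) :=
  Iff.rfl

/-- AFFINE BORDER MEMBERSHIP at size m: per_n is a coefficientwise limit of determinants of size-m
affine pencils (equivalently every `eqn_μ` tends to 0 along a sequence of genuine complex points). -/
def InBorder (n m : ℕ) : Prop :=
  ∃ A : ℕ → (U n m → ℂ), ∀ μ, Tendsto (fun k => MvPolynomial.eval (A k) ((defect n m).coeff μ)) atTop (𝓝 0)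

/-- ASYMPTOTIC PSEUDO-SOLUTIONS OF CONTACT > D: genuine points A_k (necessarily escaping to ∞ when
m < dc) along which every equation decays faster than (1+‖A_k‖)^{-(D-m)}.  An approximating
Puiseux arc with pole order N and precision K gives this for every D < m + K/N. -/
def ContactSeq (n m D : ℕ) : Prop :=
  ∃ A : ℕ → (U n m → ℂ), ∀ μ,
    Tendsto (fun k => (1 + ‖A k‖) ^ (D - m) * ‖MvPolynomial.eval (A k) ((defect n m).coeff μ)‖) atTop (𝓝 0)

/-- C⁺ (the transfer target): super-polynomial arc contact at the quadratic size ⌊n²/2⌋+1. -/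
def ContactQP : Prop := ∀ c : ℕ, ∃ n₀ : ℕ, ∀ n ≥ n₀, ContactSeq n (n ^ 2 / 2 + 1) (n ^ c)

/-! ### First lemmas of the line (signatures; proofs are for provers) -/

/-- (L0) NS ⇒ SOS at the same degree (the route's support item `NsToSos`, general form). -/
theorem sos_of_ns {n m D : ℕ} : HasNsRef n m D → HasSosRef n m D := by
  sorry

/-- (L1) PADDING MONOTONICITY: restrict a refutation of Rep(n,m+1) along `A ↦ A ⊕ [1]`
(a ring hom sending the extra unknowns to the real constants 0/1, commuting with `cj`,
not raising degrees, mapping Hermitian squares to Hermitian squares). -/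
theorem sos_padding_mono {n m D : ℕ} : HasSosRef n (m + 1) D → HasSosRef n m D := by
  sorry

theorem sos_padding_le {n m₁ m D : ℕ} (hle : m₁ ≤ m) : HasSosRef n m D → HasSosRef n m₁ D := by
  induction hle with
  | refl => exact id
  | step _ ih => exact fun hs => ih (sos_padding_mono hs)

/-- (L2) ARCS KILL BOUNDED-DEGREE SOS (positivity is free on genuine points): evaluate the
Hermitian identity at `Sum.elim (A k) (star ∘ A k)`; `q·cj q ↦ |q(A k)|² ≥ 0`, each
`h_μ·eqn_μ ↦ O((1+‖A k‖)^{D-m})·eqn_μ(A k) → 0`, and `1 ↦ 1`: contradiction in the limit. -/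
theorem not_sos_of_contactSeq {n m D : ℕ} : ContactSeq n m D → ¬ HasSosRef n m D := by
  sorry

/-- (L3) BRIANÇON–SKODA DICHOTOMY: if per_n is NOT in the affine border at size m then Rep(n,m)
has a Nullstellensatz refutation of degree ≤ (n²+1)m³ (+m slack).  Proof sketch: with
λ := coeff_id and 𝔞 := (F_μ − c_μ λ)_μ ⊂ ℂ[a] (forms of degree m, M = (n²+1)m² variables),
non-border ⇒ |λ| ≤ C·max_μ |F_μ − c_μλ| on ℂ^M ⇒ λ ∈ cl(𝔞) (Lejeune-Jalabert–Teissier /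
valuative criterion, Huneke–Swanson 6.8.3) ⇒ λ^M ∈ cl(𝔞^M) ⊆ 𝔞 (Lipman–Sathaye 1981) ⇒
1 = λ^M − (λ−1)·Σ_{i<M} λ^i is an NS identity of degree ≤ M·m. -/
theorem ns_of_not_inBorder {n m : ℕ} : ¬ InBorder n m → HasNsRef n m ((n ^ 2 + 1) * m ^ 3 + m) := by
  sorry

/-- degree budgets are monotone (same witnesses). -/
theorem sos_degree_mono {n m D D' : ℕ} (hle : D ≤ D') : HasSosRef n m D → HasSosRef n m D' := by
  intro hs
  dsimp only [HasSosRef] at hs ⊢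
  obtain ⟨k, q, h, hq, hh, hsum⟩ := hs
  exact ⟨k, q, h, fun i => (hq i).trans hle, fun μ => (hh μ).trans hle, hsum⟩

theorem ns_degree_mono {n m D D' : ℕ} (hle : D ≤ D') : HasNsRef n m D → HasNsRef n m D' := by
  intro hs
  dsimp only [HasNsRef] at hs ⊢
  obtain ⟨h, hh, hsum⟩ := hs
  exact ⟨h, fun μ => (hh μ).trans hle, hsum⟩

/-- (L4, provable now) below the degree of the permanent the system is refuted in degree 0:
`eqn_id = 0 − 1` because `det A(x)` has total degree ≤ m < n = |id|. -/
theorem ns_deg0_of_lt {n m : ℕ} (h : m < n) : HasNsRef n m 0 := by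
  sorry

/-- arithmetic: the Briançon–Skoda budget at m₁ = ⌊n²/2⌋+1 is ≤ n⁹. -/
theorem bs_budget_le_pow_nine {n : ℕ} (hn2 : 2 ≤ n) :
    (n ^ 2 + 1) * (n ^ 2 / 2 + 1) ^ 3 + (n ^ 2 / 2 + 1) ≤ n ^ 9 := by
  have hk : n ^ 2 / 2 + 1 ≤ n ^ 2 := by
    have h4 : 4 ≤ n ^ 2 := by nlinarith
    omega
  calc (n ^ 2 + 1) * (n ^ 2 / 2 + 1) ^ 3 + (n ^ 2 / 2 + 1)
      ≤ (n ^ 2 + 1) * (n ^ 2) ^ 3 + n ^ 2 := by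
        gcongr
    _ ≤ n ^ 9 := by
        have h4 : 4 ≤ n ^ 2 := by nlinarith
        have h62 : n ^ 2 ≤ n ^ 6 := Nat.pow_le_pow_right (by omega) (by norm_num)
        have h8 : n ^ 6 + n ^ 2 ≤ n ^ 8 := by
          have e : n ^ 8 = n ^ 2 * n ^ 6 := by ring
          rw [e]; nlinarith [h4, h62]
        have h9 : 2 * n ^ 8 ≤ n ^ 9 := by
          calc 2 * n ^ 8 ≤ n * n ^ 8 := by gcongr
            _ = n ^ 9 := by ring
        have e2 : (n ^ 2 + 1) * (n ^ 2) ^ 3 + n ^ 2 = n ^ 8 + (n ^ 6 + n ^ 2) := by ring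
        rw [e2]; linarith [h8, h9]

/-- arithmetic: for m ≥ n the Briançon–Skoda budget is ≤ (m+2)⁵ (the target's shape). -/
theorem bs_budget_le_window {n m : ℕ} (hnm : n ≤ m) :
    (n ^ 2 + 1) * m ^ 3 + m ≤ (m + 2) ^ 5 := by
  calc (n ^ 2 + 1) * m ^ 3 + m ≤ (m ^ 2 + 1) * m ^ 3 + m := by gcongr
    _ ≤ (m + 2) ^ 5 := by
        have e : (m + 2) ^ 5 = (m ^ 2 + 1) * m ^ 3 + m + (10 * m ^ 4 + 39 * m ^ 3 + 80 * m ^ 2 + 79 * m + 32) := by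
          ring
        rw [e]; exact Nat.le_add_right _ _

/-- the route's other two decls in the same shapes (matched BY NAME, `Iff.rfl`). -/
theorem beyondHessianNs_iff :
    BeyondHessianNs ↔ ∃ c n₀ : ℕ, ∀ n ≥ n₀, HasNsRef n (n ^ 2 / 2 + 1) (n ^ c) :=
  Iff.rfl

theorem certWindowQP_iff :
    CertWindowQP ↔ ∃ c' : ℕ, ∀ c : ℕ, ∃ n : ℕ, ∀ m ≤ 2 ^ ((Nat.log 2 n + c) ^ c), HasSosRef n m ((m + 2) ^ c') :=
  Iff.rfl

/-- eventual non-membership of per_n in the quadratic affine border ("LMR13 + 2", eventually). -/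
def EventuallyNotInBorder : Prop := ∃ n₀ : ℕ, ∀ n ≥ n₀, ¬ InBorder n (n ^ 2 / 2 + 1)

/-- affine border dc of per_n is not quasi-polynomially bounded (border / Mulmuley–Sohoni form of the
extended Valiant hypothesis, affine model, infinitely-often form; `n ≥ 2` is bookkeeping). -/
def BorderDcNotQP : Prop := ∀ c : ℕ, ∃ n ≥ 2, ∀ m ≤ 2 ^ ((Nat.log 2 n + c) ^ c), ¬ InBorder n m

/-! ### Consequences (compositions; these DO typecheck against the crux by name) -/

/-- (C4) the route's rank-2 crux follows from eventual non-border at m₁ (bounded-degree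
Nullstellensatz identities are COMPLETE for affine border-dc lower bounds). -/
theorem beyondHessianNs_of_eventuallyNotInBorder (hE : EventuallyNotInBorder) : BeyondHessianNs := by
  rw [beyondHessianNs_iff]
  obtain ⟨n₀, h⟩ := hE
  refine ⟨9, max n₀ 2, fun n hn => ?_⟩
  have hn2 : 2 ≤ n := le_trans (le_max_right _ _) hn
  exact ns_degree_mono (bs_budget_le_pow_nine hn2) (ns_of_not_inBorder (h n (le_trans (le_max_left _ _) hn)))

/-- (C5) the route's TARGET follows from the border form of the extended Valiant hypothesis. -/
theorem certWindowQP_of_borderDcNotQP (hB : BorderDcNotQP) : CertWindowQP := by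
  rw [certWindowQP_iff]
  refine ⟨5, fun c => ?_⟩
  obtain ⟨n, hn2, hnm⟩ := hB c
  refine ⟨n, fun m hm => ?_⟩
  by_cases hmn : m < n
  · exact sos_degree_mono (Nat.zero_le _) (sos_of_ns (ns_deg0_of_lt hmn))
  · exact sos_degree_mono (bs_budget_le_window (not_lt.mp hmn)) (sos_of_ns (ns_of_not_inBorder (hnm m hm)))


/-- C⁺ ⇒ crux (two lines: arcs kill SOS at m₁, padding carries it to every m ≥ m₁). -/
theorem refutationBarrier_of_contactQP (hC : ContactQP) : RefutationBarrier := by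
  rw [refutationBarrier_iff]
  intro c
  obtain ⟨n₀, hn₀⟩ := hC c
  refine ⟨n₀, fun n hn m hm hsos => ?_⟩
  exact not_sos_of_contactSeq (hn₀ n hn) (sos_padding_le hm hsos)

/-- crux ⇒ QUADRATIC AFFINE BORDER: for all large n, per_n ∈ closure of size-(⌊n²/2⌋+1) affine
determinantal expressions (the obstruction every proof of the crux must honour:
`RefutationBarrier_false_without_QuadraticBorder`). -/
theorem inBorder_of_refutationBarrier (hB : RefutationBarrier) :
    ∃ n₀ : ℕ, ∀ n ≥ n₀, InBorder n (n ^ 2 / 2 + 1) := by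
  rw [refutationBarrier_iff] at hB
  -- degree budget: (n²+1)(n²/2+1)³ + (n²/2+1) ≤ n^9 for n ≥ 2
  obtain ⟨n₀, hn₀⟩ := hB 9
  refine ⟨max n₀ 2, fun n hn => ?_⟩
  by_contra hnb
  have hns := ns_of_not_inBorder hnb
  have hn2 : 2 ≤ n := le_trans (le_max_right _ _) hn
  have hsos : HasSosRef n (n ^ 2 / 2 + 1) (n ^ 9) :=
    sos_degree_mono (bs_budget_le_pow_nine hn2) (sos_of_ns hns)
  exact hn₀ n (le_trans (le_max_left _ _) hn) _ le_rfl hsos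

/-- Conditional refutation of the crux: infinitely many n with per_n outside the quadratic
affine border (one additive step beyond Landsberg–Manivel–Ressayre's border bound n²/2)
refute `RefutationBarrier`. -/
theorem not_refutationBarrier_of_io_notInBorder
    (h : ∀ n₀ : ℕ, ∃ n ≥ n₀, ¬ InBorder n (n ^ 2 / 2 + 1)) : ¬ RefutationBarrier := by
  intro hB
  obtain ⟨n₀, hn₀⟩ := inBorder_of_refutationBarrier hB
  obtain ⟨n, hn, hnb⟩ := h n₀
  exact hnb (hn₀ n hn)

end Summit.ValiantsHypothesis.ValiantsHypothesis.Cruxes.RefutationBarrier.ArcContact
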